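import Literature.MathematicalPhysics.QuantumFieldTheory.Balaban1983to89.B9Thm310CommutatorBound389B
import Literature.MathematicalPhysics.QuantumFieldTheory.Balaban1983to89.B9Eq3104CommutatorSizesLoc

/-!
# `Balaban1983to89.B9Thm310CommutatorBound389BLoc` — T. Bałaban, *Propagators for lattice gauge theories in a background field*,
# Commun. Math. Phys. **99** (1985) 389–434 [Balaban1985BackgroundPropagators], Sect. C p. 414: «The operator K(h_□)G_□h_□ satisfies the inequality (3.89),
# hence it is small», (3.89) p. 409 «|(K(h_□)G′_□h_□λ)(x)| ≤ O(M⁻¹)e^{−δ₀(Lʲη)⁻¹|y−y′|}|λ| for x ∈ Δ(y), supp λ ⊂ Δ(y′), y, y′ ∈ □ ∈ 𝒟_j», Thm 3.3 p. 399, and the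
# class (3.35) p. 396 ∕ (3.69) p. 404: **THE BOND-SECTOR (3.89), POINTWISE, WITH A j-UNIFORM CONSTANT, FROM LEVEL-WEIGHTED HOLONOMY DATA** — E′₂b's
# `norm_KhBY_O_hTY_apply_le` re-run on E′₁-loc (`B9Eq3104CommutatorSizesLoc`) with the three small class data in print's (3.35)∕(3.69) currency
# «O(1)Mα₀(Lʲη)⁻² on Ω_j» (lattice units: a factor `L^{−2·lev}` at the level of the site), so that the constant is `theta389B … (j := 0)` for a cube of ANY level
# (module M5.7-est, file E′₂b-loc; closes the honest caveat «δ_P·Lʲ» of E′₂b `B9Thm310CommutatorBound389B` ∕ E′₄ `B9Thm310CommutatorBound389BOfInv`)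

statement-level skeleton of published theorems with citation tags; proofs where landed; nothing here is a claim about the Yang–Mills mass gap

PDF held: `paper:balaban1985-cmp99-background-propagators` (journal page = PDF page + 388); pp. 396–399, 404, 409, 413–414 read from the text layer (`p0008`–`p0011`,
`p0016`, `p0021`, `p0025`–`p0026`).  p. 396 (3.35): «for an arbitrary cube □ of the described above class, and for a configuration U there exists a gauge
transformation u on □ such that U^u = e^{iηA}. and if the index of □ is j, then |A| < O(1)Mα₀(Lʲη)⁻¹, |∇^ηA| < O(1)Mα₀(Lʲη)⁻² on □»; p. 404 after (3.69): the
estimates «|Re U(∂p) − 1| ≤ …, |Im U(∂p)| ≤ …» «follow directly from the assumptions (3.35)».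

## THE DISPLAYED INPUTS (hypotheses, NOT asserted) — as E′₂b, except that the three SMALL class data are LEVEL-WEIGHTED
* (h342₀)∕(h342₁) the VALUE and GRADIENT entries of the bond cube letter `O` at `U` in the invariant-class reading (E′₂b verbatim; Thm 3.3 p. 399 with (3.42)₁,₂).
* `hU` bi-contractive bond variables, `hT` contractive contour transporters of the averagings, `hRe : ‖Re U(∂p)‖ ≤ ρ` — global, as E′₂b (all three are `O(1)`
  data on the class: for `G`-valued unitary `U` one has `ρ = 1`).
* `hP : ‖R(U(∂p_{μλ}(w)))Y − Y‖ ≤ δ_P·(L^{lev w})⁻²·‖Y‖`, `hKc : ‖R(U_μ(x−e_μ))⁻¹𝒦_{x−e_μ}(R(U_μ(x−e_μ))Z) − 𝒦_xZ‖ ≤ δ_K·|c_f|·(L^{lev x})⁻²·‖Z‖` (Jordan insertion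
  `𝒦 = jIns U`), `hI : ‖c_f²·Im U(∂p)‖ ≤ δ_I·c_f²·(L^{lev p₀})⁻²` (`p₀` the corner of `p`) — for EVERY site ∕ plaquette, with the amplitude scaled by the level of
  the site: print's «O(1)Mα₀(Lʲη)⁻²» on `Ω_j` in lattice units (`η²·(Lʲη)⁻² = L^{−2j}`; `|c_f| = η⁻¹`, so `c_f²·L^{−2·lev} = (L^{lev}η)⁻²`).  On the class these hold
  with `δ_P, δ_K, δ_I = O(1)Mα₀·L^{O(1)}` (the tree's `B9Eq335PlaquetteAtLettersY.norm_holY_sub_one_le_of_reg335Cube` with `B9Eq335CoveragePAtLettersY.exists_cubeClassP_plaquette`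
  give `|U(∂p) − 1| ≤ 2C(1+C)e^{4C}·L^{−2(lev − 1)}`, `C = O(1)Mα₀`; the reading of the three data from it is a successor file, not here).

## WHAT THIS FILE PROVES (kernel-checked, 0 sorry; THEOREMS only; no `def`, no `def … : Prop`, no new fact)
* §1 `inv_pow_sq_le_of_le_succ` (one level step costs `L²`: `lev ≤ lev′ + 1 ⇒ (L^{lev′})⁻² ≤ L²·(L^{lev})⁻²`), ★ `arith389BLoc` — E′₂b's `arith389B` with the star
  constants `δ_P·L²·(L^{lev})⁻²`, `δ_K·|c_f|·(L^{lev})⁻²`, `δ_I·c_f²·L²·(L^{lev})⁻²` in the three slots: the value entry's `(L^{lev})²` CANCELS the weight exactly, the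
  remaining `(Lʲ)⁻¹ ≤ 1`, and the total is `theta389B d ℓ B₀ b₁ δ ρ δ_P δ_K δ_I 0 ∕ (L·M_h)·e^{−δd}·|J|` — E′₂b's constant AT `j = 0`, for every `j`.
* §2 ★★★ `norm_KhBY_O_hTY_apply_le_loc` — **THE BOND-SECTOR (3.89), POINTWISE, j-UNIFORM**: for any bond cube letter `O` with the (3.42)₁,₂-type entries
  `(B₀, δ)` (E′₂b's `h342₀`, `h342₁`), `‖(K(h_□)(U)·O(h_□Λ))(b)‖ ≤ θ₃₈₉ᴮ(d, L, B₀, b₁, δ, ρ, δ_P, δ_K, δ_I; 0)∕(L·M_h) · e^{−δd(y,y′)} · |J|` for `b ∈ Δ(βy)`,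
  `supp J ⊂ Δ(βy′)`, `‖Λ‖ ≤ |J|` — print's «O(M⁻¹)» with `M = L·M_h`, UNIFORM IN THE LEVEL `j` OF THE CUBE in every term.  Proof = E′₂b's, reading E′₁-loc at
  the star of `b`: the sites `x − e_μ` and the corners of the plaquettes through `b` lie within one lattice step of `x = chart b₋`, hence at level `≥ lev(x) − 1`
  ([4] (2.2): `lev_le_succ_of_touch'`), so the level-weighted data give star constants `δ·L²·(L^{lev x})⁻²`; then §1.
HONEST SCOPE ∕ DIVERGENCES.  (1) The three small data are HYPOTHESES in level-weighted form; this file does not read them off the class (3.35) (successor file: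
from `|U(∂p) − 1| ≤ O(1)Mα₀L²·L^{−2·lev}` one gets `δ_P = 2·O(1)Mα₀L²`, `δ_I = O(1)Mα₀L²`, `δ_K = 2·O(1)Mα₀L⁴` for unitary `G`-valued `U` — NOT proved here).
(2) Level window `lev b ≤ j + 2` (E′₂a), near entries `e^{2δ}`, bond averagings `e^{δ(2ℓ+6)}`, same rate `δ` and distance as the inputs, corner-free members,
`η = |c_f|⁻¹` — all as E′₂b.  (3) The constant is E′₂b's `theta389B` at `j = 0` (its `δ_P`-slot over-counts by `L²`, its `δ_K`-slot by `L²`; no new definition).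
(4) Nothing of Thm 3.10 ∕ 3.3 ∕ (3.42) is asserted; nothing landed is modified; nothing continuum ∕ OS ∕ mass gap ∕ Clay; YM mass gap NOT proved by any of this
(Track A conditional rung).  `--supports stmt-QuantumFields-19200`.  Net new unproved facts: 0.
-/

noncomputable section

namespace Literature.MathematicalPhysics.QuantumFieldTheory.Balaban1983to89.B9Thm310CommutatorBound389BLoc

open Node00
open B9Thm37CubeCoverCommutators (cutMulY cutMulY_apply hTY hTY_apply)
open B9Thm37CubeCoverCommutatorSizes (side_conditions)
open B9Thm37CubeCoverCommutatorSizesGrad (C1F_div_bigSide_eq)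
open B9Thm37CommutatorBound389 (norm_cutMulY_le_of_le norm_cdsS_le_norm_cdS_shift lev_le_succ_of_touch lev_le_succ_of_touch' torusSupNorm_sub_shiftY_le_one
  geo9K_dist_eq geo9K_len_eq levY_eq_lvl_of_blkOf_eq)
open B9Eq3104CutoffCommutators (hBdY hBdY_apply KhBY)
open B9Eq3104CommutatorGradFormDD (cdB_eq_cdS_bondCompY)
open B9Eq3104CommutatorSizesDD (C2X_div_bigSide_sq_eq)
open B9Eq3104CommutatorSizesLoc (norm_KhBY_hTY_apply_le_loc)
open B9Eq3104CommutatorSupport (touch_symm touch_src_edgeY levY_src_le_of_KhBY_hTY_ne_zero dist_blkOf_le_one_of_touch' dist_bondT_triangle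
  qwt_ne_zero_of_qsK_ne_zero qwt_ne_zero_of_qK_ne_zero levY_src_bounds_of_qwt_ne_zero dist_blkV1_beta_le_of_qwt_ne_zero)
open B9Thm310CommutatorBound389B (theta389B theta389B_nonneg abs_cf_eq_of_eta pow_levY_le_abs_cf step_facts two_step_facts w_le_of_band b1_pos sum_abs_qsK_le
  supNorm_inr_nonneg)
open B6KLevelCensusIndexV1 (KIdx)
open B6Ineq2142KLevelV1 (β lvl qwt qwt_nonneg)
open B6GlobalChartV1 (PV blkV1)
open B4TorusKernel.MultiPeriod (torusSupNorm)
open B6Geom246MultiLevelBox (bset blkOf)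
open B6Geom246MultiLevelTorus (bondT)
open B6MultiLevelBoxOperator (bigSide)
open B6Cover236MultiLevelBlocks (cubes)
open B6Partition118KLevelTorus (abs_hT_le_one)
open B6Partition118KLevelFineSizes (C1F C1F_nonneg)
open B6Partition118KLevelFineMixed (C2X C2X_bounds)
open B6Partition118KLevelTorusBinders (sLipT sLipT_nonneg)
open B9Eq3132Ineq2142Covariant (qK_apply)
open B9GeoNormsKLevelV1 (geo9K blkOf_level_le)
open B9GeoLemma21KLevelV1 (one_le_Mh one_le_P)
open Node00.OpsYNablaBridge (chartY bondCompY bondCompY_apply)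
open B9Eq39Adjoint (R plaqU)
open B9Eq3104CommutatorSizesCurl (jIns)
open scoped Matrix

variable {𝔸 : Type} [NormedRing 𝔸] [NormedAlgebra ℂ 𝔸] [CompleteSpace 𝔸]
variable {d ℓ : ℕ} {hd : 1 ≤ d + 1} {hL : Odd (ℓ + 1) ∧ 1 < ℓ + 1} {b₀ b₁ : ℝ}
variable (i : KIdx d ℓ hd hL b₀ b₁)

/-! ## §1 One level step costs `L²`; the level bookkeeping with the star constants -/

omit [NormedAlgebra ℂ 𝔸] [CompleteSpace 𝔸] in
/-- **ONE LEVEL STEP COSTS `L²`**: `lev ≤ lev′ + 1 ⇒ (L^{lev′})⁻² ≤ L²·(L^{lev})⁻²` (`L ≥ 1`). [cite: Balaban1984PropagatorsII, (2.2) p.224, bookkeeping] -/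
theorem inv_pow_sq_le_of_le_succ {L : ℝ} (hL1 : 1 ≤ L) {lev lev' : ℕ} (h : lev ≤ lev' + 1) :
    ((L ^ lev')⁻¹) ^ 2 ≤ L ^ 2 * ((L ^ lev)⁻¹) ^ 2 := by
  have hL0 : 0 < L := lt_of_lt_of_le one_pos hL1
  have h1 : L ^ lev ≤ L ^ lev' * L := by
    calc L ^ lev ≤ L ^ (lev' + 1) := pow_le_pow_right₀ hL1 h
      _ = L ^ lev' * L := pow_succ _ _
  have h2 : (L ^ lev')⁻¹ ≤ L * (L ^ lev)⁻¹ := by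
    rw [← div_eq_mul_inv, le_div_iff₀ (pow_pos hL0 _), inv_mul_le_iff₀ (pow_pos hL0 _)]
    exact h1
  calc ((L ^ lev')⁻¹) ^ 2 ≤ (L * (L ^ lev)⁻¹) ^ 2 := pow_le_pow_left₀ (by positivity) h2 2
    _ = L ^ 2 * ((L ^ lev)⁻¹) ^ 2 := by ring

omit [NormedAlgebra ℂ 𝔸] [CompleteSpace 𝔸] in
/-- ★ **THE LEVEL BOOKKEEPING OF THE BOND-SECTOR (3.89) WITH THE STAR CONSTANTS** — E′₂b's `arith389B` with `δ_P·L²·(L^{lev})⁻²`, `δ_K·|c_f|·(L^{lev})⁻²`,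
`δ_I·c_f²·L²·(L^{lev})⁻²` in the three small slots: the value entry's `(L^{lev+2}|c_f|⁻¹)²` cancels the weights EXACTLY, the surviving `(Lʲ)⁻¹ ≤ 1`, and the total is
E′₂b's constant at `j = 0` — for every `j`. [cite: Balaban1985BackgroundPropagators, (3.89) p.409 («O(M⁻¹)»), p.414 l.1–3, (3.35) p.396, arithmetic] -/
theorem arith389BLoc {dR L Mh C₁ C₂ s B₀ b₁ cf e₂ e₆ E F ρ δP δK δI X : ℝ} {j lev dd : ℕ} (hd : 0 ≤ dR) (hL1 : 1 ≤ L) (hMh1 : 1 ≤ Mh)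
    (hC₁ : 0 ≤ C₁) (hC₂ : 0 ≤ C₂) (hB₀ : 0 ≤ B₀) (hcf1 : 1 ≤ cf) (he₂ : 0 ≤ e₂) (hE : 0 ≤ E) (hF : 0 ≤ F)
    (hρ : 0 ≤ ρ) (hδP : 0 ≤ δP) (hδK : 0 ≤ δK) (hδI : 0 ≤ δI) (hlev : lev ≤ j + 2)
    (hX : X ≤ cf * ((dR + 1) * (4 * (cf * ρ * (2 * (5 / 8 * C₁ / (L * Mh) * (L ^ j)⁻¹) * (B₀ * (L ^ (lev + 2) * cf⁻¹) * cf⁻¹ * e₂ * E * F)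
            + ((5 / 8 * C₁ / (L * Mh) * (L ^ j)⁻¹) * (δP * L ^ 2 * ((L ^ lev)⁻¹) ^ 2) + (5 / 8) ^ 2 * C₂ / (L * Mh) ^ 2 * ((L ^ j) ^ 2)⁻¹)
              * (B₀ * (L ^ (lev + 2) * cf⁻¹) ^ 2 * e₂ * E * F))
            + (5 / 8 * C₁ / (L * Mh) * (L ^ j)⁻¹) * (δK * cf * ((L ^ lev)⁻¹) ^ 2) * (B₀ * (L ^ (lev + 2) * cf⁻¹) ^ 2 * e₂ * E * F))))
        + 64 * (dR + 1) * (δI * cf ^ 2 * L ^ 2 * ((L ^ lev)⁻¹) ^ 2) * (5 / 8 * C₁ / (L * Mh) * (L ^ j)⁻¹) * (B₀ * (L ^ (lev + 2) * cf⁻¹) ^ 2 * e₂ * E * F)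
        + cf ^ 2 * ((dR + 1) * (2 * (5 / 8 * C₁ / (L * Mh) * (L ^ j)⁻¹) * (B₀ * (L ^ (lev + 2) * cf⁻¹) * cf⁻¹ * e₂ * E * F)
            + ((5 / 8 * C₁ / (L * Mh) * (L ^ j)⁻¹) * (δP * L ^ 2 * ((L ^ lev)⁻¹) ^ 2) + (5 / 8) ^ 2 * C₂ / (L * Mh) ^ 2 * ((L ^ j) ^ 2)⁻¹)
              * (B₀ * (L ^ (lev + 2) * cf⁻¹) ^ 2 * e₂ * E * F)))
        + 4 * (s / (L * Mh) * (L + 3)) * (b₁ * B₀ * L ^ dd * e₆ * E * F)) :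
    X ≤ B₀ * (e₂ * ((4 * ρ + 1) * (dR + 1) * (2 * (5 / 8 * C₁) * L ^ 4 + (5 / 8) ^ 2 * C₂ * L ^ 8 + (5 / 8 * C₁) * L ^ 8 * δP * L ^ (0 : ℕ))
        + (dR + 1) * (5 / 8 * C₁) * L ^ 6 * (4 * δK + 64 * δI)) + 4 * (s * (L + 3)) * b₁ * L ^ dd * e₆) / (L * Mh) * E * F := by
  have hL0 : 0 < L := lt_of_lt_of_le one_pos hL1
  have hM0 : 0 < Mh := lt_of_lt_of_le one_pos hMh1
  have hLM : 0 < L * Mh := mul_pos hL0 hM0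
  have hLM1 : 1 ≤ L * Mh := by nlinarith
  have hc0 : 0 < cf := lt_of_lt_of_le one_pos hcf1
  have hcne : cf ≠ 0 := hc0.ne'
  have hLne : L ≠ 0 := hL0.ne'
  have hMne : Mh ≠ 0 := hM0.ne'
  have hLj : 0 < L ^ j := pow_pos hL0 _
  have hΛ0 : 0 < L ^ lev := pow_pos hL0 _
  have hΛne : L ^ lev ≠ 0 := hΛ0.ne'
  have hLjne : L ^ j ≠ 0 := hLj.ne'
  -- abbreviations
  set K₁ : ℝ := 5 / 8 * C₁ / (L * Mh) with hK₁
  set K₂ : ℝ := (5 / 8) ^ 2 * C₂ / (L * Mh) ^ 2 with hK₂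
  set W : ℝ := B₀ * e₂ * E * F with hW
  have hK₁0 : 0 ≤ K₁ := by positivity
  have hK₂0 : 0 ≤ K₂ := by positivity
  have hW0 : 0 ≤ W := by positivity
  -- the weights cancel the value entry's `(L^lev)²` exactly; every `c_f` cancels
  set Y : ℝ := 2 * (K₁ * (L ^ j)⁻¹) * (W * (L ^ lev * L ^ 2)) + K₁ * (L ^ j)⁻¹ * δP * L ^ 6 * W + K₂ * ((L ^ j) ^ 2)⁻¹ * (W * (L ^ lev * L ^ 2) ^ 2)
    with hY
  have hX' : X ≤ 4 * (dR + 1) * (ρ * Y + K₁ * (L ^ j)⁻¹ * δK * L ^ 4 * W)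
      + 64 * (dR + 1) * δI * (K₁ * (L ^ j)⁻¹) * L ^ 6 * W + (dR + 1) * Y
      + 4 * (s / (L * Mh) * (L + 3)) * (b₁ * B₀ * L ^ dd * e₆ * E * F) := by
    refine hX.trans (le_of_eq ?_)
    rw [hY, hW, hK₁, hK₂, pow_add]
    field_simp
    ring
  clear hX
  -- the level window `L^lev ≤ L^j·L²`, and `(L^j)⁻¹ ≤ 1`
  have hpow : L ^ lev ≤ L ^ j * L ^ 2 := by
    calc L ^ lev ≤ L ^ (j + 2) := pow_le_pow_right₀ hL1 hlev
      _ = L ^ j * L ^ 2 := pow_add _ _ _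
  have A1 : (L ^ j)⁻¹ * L ^ lev ≤ L ^ 2 := by rw [inv_mul_le_iff₀ hLj]; exact hpow
  have A3 : ((L ^ j) ^ 2)⁻¹ * (L ^ lev) ^ 2 ≤ L ^ 4 := by
    rw [inv_mul_le_iff₀ (by positivity)]
    calc (L ^ lev) ^ 2 ≤ (L ^ j * L ^ 2) ^ 2 := pow_le_pow_left₀ hΛ0.le hpow 2
      _ = (L ^ j) ^ 2 * L ^ 4 := by ring
  have Aj : (L ^ j)⁻¹ ≤ 1 := inv_le_one_of_one_le₀ (one_le_pow₀ hL1)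
  have A6 : ((L * Mh) ^ 2)⁻¹ ≤ (L * Mh)⁻¹ := by
    rw [inv_le_inv₀ (by positivity) hLM, sq]; exact le_mul_of_one_le_left hLM.le hLM1
  have hK₂' : K₂ ≤ (5 / 8) ^ 2 * C₂ / (L * Mh) := by
    rw [hK₂, div_eq_mul_inv, div_eq_mul_inv]; exact mul_le_mul_of_nonneg_left A6 (by positivity)
  have hL46 : L ^ 4 ≤ L ^ 6 := pow_le_pow_right₀ hL1 (by norm_num)
  have hL68 : L ^ 6 ≤ L ^ 8 := pow_le_pow_right₀ hL1 (by norm_num)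
  -- term bounds
  have t1 : 2 * (K₁ * (L ^ j)⁻¹) * (W * (L ^ lev * L ^ 2)) ≤ 2 * K₁ * L ^ 4 * W := by
    have e : 2 * (K₁ * (L ^ j)⁻¹) * (W * (L ^ lev * L ^ 2)) = 2 * K₁ * L ^ 2 * W * ((L ^ j)⁻¹ * L ^ lev) := by ring
    rw [e]
    calc 2 * K₁ * L ^ 2 * W * ((L ^ j)⁻¹ * L ^ lev) ≤ 2 * K₁ * L ^ 2 * W * L ^ 2 := mul_le_mul_of_nonneg_left A1 (by positivity)
      _ = 2 * K₁ * L ^ 4 * W := by ring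
  have t2 : K₁ * (L ^ j)⁻¹ * δP * L ^ 6 * W ≤ K₁ * L ^ 8 * δP * L ^ (0 : ℕ) * W := by
    rw [pow_zero, mul_one]
    have e : K₁ * (L ^ j)⁻¹ * δP * L ^ 6 * W = K₁ * δP * W * ((L ^ j)⁻¹ * L ^ 6) := by ring
    rw [e]
    calc K₁ * δP * W * ((L ^ j)⁻¹ * L ^ 6) ≤ K₁ * δP * W * (1 * L ^ 8) :=
          mul_le_mul_of_nonneg_left (mul_le_mul Aj hL68 (by positivity) zero_le_one) (by positivity)
      _ = K₁ * L ^ 8 * δP * W := by ring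
  have t3 : K₂ * ((L ^ j) ^ 2)⁻¹ * (W * (L ^ lev * L ^ 2) ^ 2) ≤ (5 / 8) ^ 2 * C₂ / (L * Mh) * L ^ 8 * W := by
    have e : K₂ * ((L ^ j) ^ 2)⁻¹ * (W * (L ^ lev * L ^ 2) ^ 2) = K₂ * L ^ 4 * W * (((L ^ j) ^ 2)⁻¹ * (L ^ lev) ^ 2) := by ring
    rw [e]
    calc K₂ * L ^ 4 * W * (((L ^ j) ^ 2)⁻¹ * (L ^ lev) ^ 2) ≤ K₂ * L ^ 4 * W * L ^ 4 := mul_le_mul_of_nonneg_left A3 (by positivity)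
      _ = K₂ * (L ^ 8 * W) := by ring
      _ ≤ (5 / 8) ^ 2 * C₂ / (L * Mh) * (L ^ 8 * W) := mul_le_mul_of_nonneg_right hK₂' (by positivity)
      _ = (5 / 8) ^ 2 * C₂ / (L * Mh) * L ^ 8 * W := by ring
  have t4 : K₁ * (L ^ j)⁻¹ * δK * L ^ 4 * W ≤ K₁ * L ^ 6 * δK * W := by
    have e : K₁ * (L ^ j)⁻¹ * δK * L ^ 4 * W = K₁ * δK * W * ((L ^ j)⁻¹ * L ^ 4) := by ring
    rw [e]
    calc K₁ * δK * W * ((L ^ j)⁻¹ * L ^ 4) ≤ K₁ * δK * W * (1 * L ^ 6) :=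
          mul_le_mul_of_nonneg_left (mul_le_mul Aj hL46 (by positivity) zero_le_one) (by positivity)
      _ = K₁ * L ^ 6 * δK * W := by ring
  have t5 : 64 * (dR + 1) * δI * (K₁ * (L ^ j)⁻¹) * L ^ 6 * W ≤ 64 * (dR + 1) * δI * K₁ * L ^ 6 * W := by
    have e : 64 * (dR + 1) * δI * (K₁ * (L ^ j)⁻¹) * L ^ 6 * W = 64 * (dR + 1) * δI * K₁ * L ^ 6 * W * (L ^ j)⁻¹ := by ring
    rw [e]
    calc 64 * (dR + 1) * δI * K₁ * L ^ 6 * W * (L ^ j)⁻¹ ≤ 64 * (dR + 1) * δI * K₁ * L ^ 6 * W * 1 := mul_le_mul_of_nonneg_left Aj (by positivity)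
      _ = _ := mul_one _
  have hYb : Y ≤ 2 * K₁ * L ^ 4 * W + (K₁ * L ^ 8 * δP * L ^ (0 : ℕ) * W + (5 / 8) ^ 2 * C₂ / (L * Mh) * L ^ 8 * W) := by
    have e : Y = 2 * (K₁ * (L ^ j)⁻¹) * (W * (L ^ lev * L ^ 2)) + (K₁ * (L ^ j)⁻¹ * δP * L ^ 6 * W + K₂ * ((L ^ j) ^ 2)⁻¹ * (W * (L ^ lev * L ^ 2) ^ 2)) := by
      rw [hY]; ring
    rw [e]
    exact add_le_add t1 (add_le_add t2 t3)
  have hρY : ρ * Y ≤ ρ * (2 * K₁ * L ^ 4 * W + (K₁ * L ^ 8 * δP * L ^ (0 : ℕ) * W + (5 / 8) ^ 2 * C₂ / (L * Mh) * L ^ 8 * W)) :=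
    mul_le_mul_of_nonneg_left hYb hρ
  have h4 : 4 * (dR + 1) * (ρ * Y + K₁ * (L ^ j)⁻¹ * δK * L ^ 4 * W)
      ≤ 4 * (dR + 1) * (ρ * (2 * K₁ * L ^ 4 * W + (K₁ * L ^ 8 * δP * L ^ (0 : ℕ) * W + (5 / 8) ^ 2 * C₂ / (L * Mh) * L ^ 8 * W)) + K₁ * L ^ 6 * δK * W) :=
    mul_le_mul_of_nonneg_left (add_le_add hρY t4) (by positivity)
  have h6 : (dR + 1) * Y ≤ (dR + 1) * (2 * K₁ * L ^ 4 * W + (K₁ * L ^ 8 * δP * L ^ (0 : ℕ) * W + (5 / 8) ^ 2 * C₂ / (L * Mh) * L ^ 8 * W)) :=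
    mul_le_mul_of_nonneg_left hYb (by linarith)
  have hfin : X ≤ 4 * (dR + 1) * (ρ * (2 * K₁ * L ^ 4 * W + (K₁ * L ^ 8 * δP * L ^ (0 : ℕ) * W + (5 / 8) ^ 2 * C₂ / (L * Mh) * L ^ 8 * W)) + K₁ * L ^ 6 * δK * W)
      + 64 * (dR + 1) * δI * K₁ * L ^ 6 * W
      + (dR + 1) * (2 * K₁ * L ^ 4 * W + (K₁ * L ^ 8 * δP * L ^ (0 : ℕ) * W + (5 / 8) ^ 2 * C₂ / (L * Mh) * L ^ 8 * W))
      + 4 * (s / (L * Mh) * (L + 3)) * (b₁ * B₀ * L ^ dd * e₆ * E * F) := by linarith [hX', h4, t5, h6]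
  refine hfin.trans (le_of_eq ?_)
  rw [hK₁, hW]
  ring

/-! ## §2 The bond-sector (3.89) pointwise, with a j-uniform constant -/

/-- ★★★ **THE BOND-SECTOR (3.89), POINTWISE, AT def-Y's LETTERS, j-UNIFORM** — for ANY bond cube letter `O` at the configuration `U` whose VALUE and GRADIENT
entries obey Thm 3.3's (3.42)₁,₂ with constants `(B₀, δ)` in the invariant-class reading (E′₂b's displayed hypotheses `h342₀`, `h342₁`), at bi-contractive bond
variables and contour transporters with `‖Re U(∂p)‖ ≤ ρ`, and with the three small class data LEVEL-WEIGHTED in print's (3.35)∕(3.69) currency (plaquette-holonomy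
defect `δ_P·(L^{lev})⁻²`, Jordan conjugation defect `δ_K·|c_f|·(L^{lev})⁻²`, curvature smallness `‖c_f²Im U(∂p)‖ ≤ δ_I·c_f²·(L^{lev})⁻²`), a corner-free member
(`ιB` a section of `β`) with `η = |c_f|⁻¹`:
`‖(K(h_□)(U)(O(h_□Λ)))(b)‖ ≤ θ₃₈₉ᴮ(d, L, B₀, b₁, δ, ρ, δ_P, δ_K, δ_I; 0)∕(L·M_h) · e^{−δ d(y,y′)} · |J|` for `b ∈ Δ(βy)`, `supp J ⊂ Δ(βy′)`, `‖Λ‖ ≤ |J|` — print's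
«The operator K(h_□)G_□h_□ satisfies the inequality (3.89)» with «O(M⁻¹)», `M = L·M_h`, the constant INDEPENDENT of the level `j` of the cube `□`.
[cite: Balaban1985BackgroundPropagators, p.414 («satisfies the inequality (3.89)»), (3.89) p.409, Thm 3.3 p.399, (3.35) p.396, (3.69) p.404; Balaban1984PropagatorsII, (2.43)–(2.44) p.230] -/
theorem norm_KhBY_O_hTY_apply_le_loc (c : ↥(cubes i.D.toDomains)) (parB : BondParY 𝔸 i) (U : CfgY 𝔸 i)
    (O : (FBondY i → 𝔸) →ₗ[ℂ] (FBondY i → 𝔸)) {B₀ δ : ℝ} (hB₀ : 0 ≤ B₀) (hδ : 0 ≤ δ)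
    (hη : etaS i = |i.cf|⁻¹) (ιB : BlkY i → IBondY i) (hι : ∀ s, β i.hN i.D i.hk (ιB s) = s)
    (hU : ∀ μ x, ‖(U μ x : 𝔸)‖ ≤ 1 ∧ ‖(((U μ x)⁻¹ : 𝔸ˣ) : 𝔸)‖ ≤ 1)
    (hT : ∀ (y : IBondY i) (f : FBondY i), ‖(qT i parB U y f : 𝔸)‖ ≤ 1 ∧ ‖(((qT i parB U y f)⁻¹ : 𝔸ˣ) : 𝔸)‖ ≤ 1)
    {δP ρ δK δI : ℝ} (hδP : 0 ≤ δP) (hρ : 0 ≤ ρ) (hδK : 0 ≤ δK) (hδI : 0 ≤ δI)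
    (hP : ∀ (μ lam : Fin (d + 1)) (w : SiteY i) (Y : 𝔸),
      ‖R (plaqU (shiftY i) (UboxY i U) μ lam w) Y - Y‖ ≤ δP * ((((ℓ : ℝ) + 1) ^ levY i w)⁻¹) ^ 2 * ‖Y‖)
    (hRe : ∀ p : PlaqY i, ‖reHolY i U p‖ ≤ ρ)
    (hKc : ∀ a e (μ : Fin (d + 1)) (x : SiteY i) (Z : 𝔸),
      ‖R (UboxY i U μ ((shiftY i μ).symm x))⁻¹ (jIns i U a e ((shiftY i μ).symm x) (R (UboxY i U μ ((shiftY i μ).symm x)) Z)) - jIns i U a e x Z‖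
        ≤ δK * |i.cf| * ((((ℓ : ℝ) + 1) ^ levY i x)⁻¹) ^ 2 * ‖Z‖)
    (hI : ∀ p : PlaqY i, ‖((i.cf ^ 2 : ℝ) : ℂ) • imHolY i U p‖ ≤ δI * i.cf ^ 2 * ((((ℓ : ℝ) + 1) ^ levY i (chartY i p.src))⁻¹) ^ 2)
    (h342₀ : ∀ (J : FBondY i → ℝ) (y y' : IBondY i), (geo9K i).suppIn (Sum.inr J) y' →
      ∀ Λ : FBondY i → 𝔸, (∀ x, ‖Λ x‖ ≤ |J x|) → ∀ x : FBondY i, blkV1 i.hN i.D x = β i.hN i.D i.hk y →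
        ‖O Λ x‖ ≤ B₀ * (geo9K i).len y ^ 2 * Real.exp (-(δ * (geo9K i).dist y y')) * (geo9K i).supNorm (Sum.inr J))
    (h342₁ : ∀ (J : FBondY i → ℝ) (y y' : IBondY i), (geo9K i).suppIn (Sum.inr J) y' →
      ∀ Λ : FBondY i → 𝔸, (∀ x, ‖Λ x‖ ≤ |J x|) → ∀ (x : FBondY i) (ν : Fin (d + 1)), blkV1 i.hN i.D x = β i.hN i.D i.hk y →
        ‖cdB i U ν (O Λ) x‖ ≤ B₀ * (geo9K i).len y * Real.exp (-(δ * (geo9K i).dist y y')) * (geo9K i).supNorm (Sum.inr J))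
    (J : FBondY i → ℝ) (y y' : IBondY i) (hs : (geo9K i).suppIn (Sum.inr J) y')
    (Λ : FBondY i → 𝔸) (hΛ : ∀ x, ‖Λ x‖ ≤ |J x|) (b : FBondY i) (hb : blkV1 i.hN i.D b = β i.hN i.D i.hk y) :
    ‖KhBY i (hTY i c) parB U (O (cutMulY (hBdY i (hTY i c)) Λ)) b‖
      ≤ theta389B d ℓ B₀ b₁ δ ρ δP δK δI 0 / (((ℓ : ℝ) + 1) * i.Mh) * Real.exp (-(δ * (geo9K i).dist y y'))
          * (geo9K i).supNorm (Sum.inr J) := by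
  obtain ⟨_, hMh2, _, _⟩ := side_conditions i
  have hL1 : (1 : ℝ) ≤ (ℓ : ℝ) + 1 := by linarith [(Nat.cast_nonneg ℓ : (0 : ℝ) ≤ ℓ)]
  have hL0 : (0 : ℝ) < (ℓ : ℝ) + 1 := by linarith
  have hMh1 : (1 : ℝ) ≤ i.Mh := by exact_mod_cast (le_trans (by norm_num) hMh2)
  have hb₁ : 0 < b₁ := b1_pos i y
  set E : ℝ := Real.exp (-(δ * (geo9K i).dist y y')) with hEdef
  set S : ℝ := (geo9K i).supNorm (Sum.inr J) with hSdef
  have hE0 : 0 ≤ E := (Real.exp_pos _).le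
  have hS0 : 0 ≤ S := supNorm_inr_nonneg i J b
  have hcf : |i.cf| = ((ℓ : ℝ) + 1) ^ i.k := abs_cf_eq_of_eta i hη
  have hcf1 : 1 ≤ |i.cf| := by rw [hcf]; exact one_le_pow₀ hL1
  have hc0 : 0 < |i.cf| := lt_of_lt_of_le one_pos hcf1
  -- the zero case is trivial
  by_cases h0 : KhBY i (hTY i c) parB U (O (cutMulY (hBdY i (hTY i c)) Λ)) b = 0
  · rw [h0, norm_zero]
    exact mul_nonneg (mul_nonneg (div_nonneg (theta389B_nonneg d ℓ hB₀ hb₁.le hρ hδP hδK hδI δ _) (by positivity)) hE0) hS0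
  -- the level window (E′₂a)
  set S₀ : SiteY i := chartY i b.src with hS₀def
  set lev : ℕ := levY i S₀ with hlevdef
  have hlev : lev ≤ c.1.1 + 2 := levY_src_le_of_KhBY_hTY_ne_zero i c parB U _ b h0
  -- the profile of `h_□Λ`, and the argument `A = O(h_□Λ)`
  set A : FBondY i → 𝔸 := O (cutMulY (hBdY i (hTY i c)) Λ) with hAdef
  have hΛ' : ∀ x, ‖cutMulY (hBdY i (hTY i c)) Λ x‖ ≤ |J x| :=
    norm_cutMulY_le_of_le (fun x => abs_hT_le_one i.D (one_le_Mh i) (one_le_P i) c _) hΛ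
  -- lengths: `ℓ(y₁) = L^{lev w}·|c_f|⁻¹` whenever `Δ(w) = β y₁`
  have hlen : ∀ {w : SiteY i} {y₁ : IBondY i}, blkOf i.D.toDomains w = β i.hN i.D i.hk y₁ →
      (geo9K i).len y₁ = ((ℓ : ℝ) + 1) ^ levY i w * |i.cf|⁻¹ := fun {w y₁} hw => by
    rw [geo9K_len_eq, ← levY_eq_lvl_of_blkOf_eq i hw, div_eq_mul_inv]; push_cast; rfl
  have hbS₀ : blkOf i.D.toDomains S₀ = β i.hN i.D i.hk y := hb
  -- (A) THE VALUE ENTRY AT A BOND OF THE STENCIL (block within `2`, level within `+2`)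
  set G₀ : ℝ := B₀ * (((ℓ : ℝ) + 1) ^ (lev + 2) * |i.cf|⁻¹) ^ 2 * Real.exp (2 * δ) * E * S with hG₀def
  have hG₀0 : 0 ≤ G₀ := by positivity
  have hval : ∀ x : FBondY i, ((bondT i.D).dist (blkOf i.D.toDomains S₀) (blkOf i.D.toDomains (chartY i x.src)) : ℝ) ≤ 2 →
      levY i (chartY i x.src) ≤ lev + 2 → ‖A x‖ ≤ G₀ := by
    intro x hdx hlx
    have hx : blkOf i.D.toDomains (chartY i x.src) = β i.hN i.D i.hk (ιB (blkOf i.D.toDomains (chartY i x.src))) := by rw [hι]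
    have h := h342₀ J _ y' hs _ hΛ' x hx
    rw [hlen (w := chartY i x.src) hx] at h
    have hpow : ((ℓ : ℝ) + 1) ^ levY i (chartY i x.src) ≤ ((ℓ : ℝ) + 1) ^ (lev + 2) := pow_le_pow_right₀ hL1 hlx
    have hdist : (geo9K i).dist y y' ≤ 2 + (geo9K i).dist (ιB (blkOf i.D.toDomains (chartY i x.src))) y' := by
      rw [geo9K_dist_eq, geo9K_dist_eq, ← hbS₀, ← hx]
      have t := dist_bondT_triangle i (blkOf i.D.toDomains S₀) (blkOf i.D.toDomains (chartY i x.src)) (β i.hN i.D i.hk y')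
      linarith
    have hexp : Real.exp (-(δ * (geo9K i).dist (ιB (blkOf i.D.toDomains (chartY i x.src))) y')) ≤ Real.exp (2 * δ) * E := by
      rw [hEdef, ← Real.exp_add]
      have := mul_le_mul_of_nonneg_left hdist hδ
      exact Real.exp_le_exp.2 (by linarith)
    calc ‖A x‖ ≤ B₀ * (((ℓ : ℝ) + 1) ^ levY i (chartY i x.src) * |i.cf|⁻¹) ^ 2
          * Real.exp (-(δ * (geo9K i).dist (ιB (blkOf i.D.toDomains (chartY i x.src))) y')) * S := h
      _ ≤ B₀ * (((ℓ : ℝ) + 1) ^ (lev + 2) * |i.cf|⁻¹) ^ 2 * (Real.exp (2 * δ) * E) * S := by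
          refine mul_le_mul_of_nonneg_right ?_ hS0
          exact mul_le_mul (mul_le_mul_of_nonneg_left (pow_le_pow_left₀ (by positivity) (mul_le_mul_of_nonneg_right hpow (by positivity)) 2) hB₀)
            hexp (Real.exp_pos _).le (by positivity)
      _ = G₀ := by rw [hG₀def]; ring
  -- (B) THE GRADIENT ENTRY AT A BOND OF THE STENCIL
  set G₁ : ℝ := B₀ * (((ℓ : ℝ) + 1) ^ (lev + 2) * |i.cf|⁻¹) * |i.cf|⁻¹ * Real.exp (2 * δ) * E * S with hG₁def
  have hgrad : ∀ (x : FBondY i) (ν : Fin (d + 1)), ((bondT i.D).dist (blkOf i.D.toDomains S₀) (blkOf i.D.toDomains (chartY i x.src)) : ℝ) ≤ 2 →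
      levY i (chartY i x.src) ≤ lev + 2 → ‖cdB i U ν A x‖ ≤ |i.cf| * G₁ := by
    intro x ν hdx hlx
    have hx : blkOf i.D.toDomains (chartY i x.src) = β i.hN i.D i.hk (ιB (blkOf i.D.toDomains (chartY i x.src))) := by rw [hι]
    have h := h342₁ J _ y' hs _ hΛ' x ν hx
    rw [hlen (w := chartY i x.src) hx] at h
    have hpow : ((ℓ : ℝ) + 1) ^ levY i (chartY i x.src) ≤ ((ℓ : ℝ) + 1) ^ (lev + 2) := pow_le_pow_right₀ hL1 hlx
    have hdist : (geo9K i).dist y y' ≤ 2 + (geo9K i).dist (ιB (blkOf i.D.toDomains (chartY i x.src))) y' := by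
      rw [geo9K_dist_eq, geo9K_dist_eq, ← hbS₀, ← hx]
      have t := dist_bondT_triangle i (blkOf i.D.toDomains S₀) (blkOf i.D.toDomains (chartY i x.src)) (β i.hN i.D i.hk y')
      linarith
    have hexp : Real.exp (-(δ * (geo9K i).dist (ιB (blkOf i.D.toDomains (chartY i x.src))) y')) ≤ Real.exp (2 * δ) * E := by
      rw [hEdef, ← Real.exp_add]
      have := mul_le_mul_of_nonneg_left hdist hδ
      exact Real.exp_le_exp.2 (by linarith)
    calc ‖cdB i U ν A x‖ ≤ B₀ * (((ℓ : ℝ) + 1) ^ levY i (chartY i x.src) * |i.cf|⁻¹)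
          * Real.exp (-(δ * (geo9K i).dist (ιB (blkOf i.D.toDomains (chartY i x.src))) y')) * S := h
      _ ≤ B₀ * (((ℓ : ℝ) + 1) ^ (lev + 2) * |i.cf|⁻¹) * (Real.exp (2 * δ) * E) * S := by
          refine mul_le_mul_of_nonneg_right ?_ hS0
          exact mul_le_mul (mul_le_mul_of_nonneg_left (mul_le_mul_of_nonneg_right hpow (by positivity)) hB₀) hexp (Real.exp_pos _).le
            (by positivity)
      _ = |i.cf| * G₁ := by rw [hG₁def]; field_simp
  -- (B′) the same read on the components
  have hvalw : ∀ (w : SiteY i) (a : Fin (d + 1)), ((bondT i.D).dist (blkOf i.D.toDomains S₀) (blkOf i.D.toDomains w) : ℝ) ≤ 2 →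
      levY i w ≤ lev + 2 → ‖bondCompY i a A w‖ ≤ G₀ := by
    intro w a hdw hlw
    have h := hval ⟨(chartY i).symm w, a⟩
    have e : chartY i ((⟨(chartY i).symm w, a⟩ : FBondY i).src) = w := Equiv.apply_symm_apply _ _
    rw [e] at h
    rw [bondCompY_apply]
    exact h hdw hlw
  have hgradw : ∀ (w : SiteY i) (a ν : Fin (d + 1)), ((bondT i.D).dist (blkOf i.D.toDomains S₀) (blkOf i.D.toDomains w) : ℝ) ≤ 2 →
      levY i w ≤ lev + 2 → ‖cdS i U ν (bondCompY i a A) w‖ ≤ G₁ := by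
    intro w a ν hdw hlw
    have h := hgrad ⟨(chartY i).symm w, a⟩ ν
    have e : chartY i ((⟨(chartY i).symm w, a⟩ : FBondY i).src) = w := Equiv.apply_symm_apply _ _
    rw [e, cdB_eq_cdS_bondCompY] at h
    have h' := h hdw hlw
    rw [e, norm_smul, Complex.norm_real, Real.norm_eq_abs] at h'
    exact le_of_mul_le_mul_left h' hc0
  -- the sites of E′₁-loc's local data are within two lattice steps of `chart b₋`
  have hUb : ∀ (μ : Fin (d + 1)) (z : SiteY i), ‖(UboxY i U μ z : 𝔸)‖ ≤ 1 ∧ ‖(((UboxY i U μ z)⁻¹ : 𝔸ˣ) : 𝔸)‖ ≤ 1 := fun μ z => hU μ _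
  have near1 : ∀ μ : Fin (d + 1), ((bondT i.D).dist (blkOf i.D.toDomains S₀) (blkOf i.D.toDomains ((shiftY i μ).symm S₀)) : ℝ) ≤ 2
      ∧ levY i ((shiftY i μ).symm S₀) ≤ lev + 2 := fun μ => by
    obtain ⟨d1, l1⟩ := step_facts i (torusSupNorm_sub_shiftY_le_one i μ S₀).2
    exact ⟨by linarith, by omega⟩
  have near2 : ∀ lam μ : Fin (d + 1), ((bondT i.D).dist (blkOf i.D.toDomains S₀) (blkOf i.D.toDomains (shiftY i lam ((shiftY i μ).symm S₀))) : ℝ) ≤ 2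
      ∧ levY i (shiftY i lam ((shiftY i μ).symm S₀)) ≤ lev + 2 := fun lam μ =>
    two_step_facts i (torusSupNorm_sub_shiftY_le_one i μ S₀).2 (torusSupNorm_sub_shiftY_le_one i lam _).1
  have near2' : ∀ lam μ : Fin (d + 1), ((bondT i.D).dist (blkOf i.D.toDomains S₀) (blkOf i.D.toDomains ((shiftY i μ).symm (shiftY i lam S₀))) : ℝ) ≤ 2
      ∧ levY i ((shiftY i μ).symm (shiftY i lam S₀)) ≤ lev + 2 := fun lam μ =>
    two_step_facts i (torusSupNorm_sub_shiftY_le_one i lam S₀).1 (torusSupNorm_sub_shiftY_le_one i μ _).2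
  have hA₀ : ∀ a lam μ : Fin (d + 1), ‖bondCompY i a A ((shiftY i μ).symm (chartY i b.src))‖ ≤ G₀
      ∧ ‖bondCompY i a A (shiftY i lam ((shiftY i μ).symm (chartY i b.src)))‖ ≤ G₀ := fun a lam μ =>
    ⟨hvalw _ a (near1 μ).1 (near1 μ).2, hvalw _ a (near2 lam μ).1 (near2 lam μ).2⟩
  have hA₀' : ∀ (p : PlaqY i) (m l : Fin 4), edgeY i p m = b → ‖A (edgeY i p l)‖ ≤ G₀ := by
    intro p m l hm
    have t₁ : torusSupNorm (toKT i).NB (S₀.1 - (chartY i p.src).1) ≤ 1 := by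
      rw [hS₀def, ← hm]; exact touch_symm i (touch_src_edgeY i p m)
    obtain ⟨d2, l2⟩ := two_step_facts i t₁ (touch_src_edgeY i p l)
    exact hval (edgeY i p l) d2 l2
  have hA₁ : ∀ a lam μ : Fin (d + 1), ‖cdS i U lam (bondCompY i a A) ((shiftY i μ).symm (chartY i b.src))‖ ≤ G₁
      ∧ ‖cdsS i U μ (bondCompY i a A) (shiftY i lam (chartY i b.src))‖ ≤ G₁ := fun a lam μ =>
    ⟨hgradw _ a lam (near1 μ).1 (near1 μ).2,
      (norm_cdsS_le_norm_cdS_shift i U hUb μ _ _).trans (hgradw _ a μ (near2' lam μ).1 (near2' lam μ).2)⟩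
  -- (C) THE AVERAGING PRODUCT `w_y‖A(f)‖ ≤ P` on the double blocks met
  set P : ℝ := b₁ * B₀ * (((ℓ : ℝ) + 1) ^ (lev + 1)) ^ (d + 1) * Real.exp (δ * (2 * (ℓ : ℝ) + 6)) * E * S with hPdef
  have hAP : ∀ (y₂ : IBondY i) (f : FBondY i), qsK i b y₂ ≠ 0 → qK i y₂ f ≠ 0 → i.w y₂ * ‖A f‖ ≤ P := by
    intro y₂ f hy₂ hf
    have hqb := qwt_ne_zero_of_qsK_ne_zero i hy₂
    have hqf := qwt_ne_zero_of_qK_ne_zero i hf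
    have hj₂ : lvl i.hN i.D i.hk y₂ ≤ lev + 1 := by
      have := (levY_src_bounds_of_qwt_ne_zero i hqb).1
      rw [← hS₀def, ← hlevdef] at this
      omega
    have hlf : levY i (chartY i f.src) ≤ lvl i.hN i.D i.hk y₂ := (levY_src_bounds_of_qwt_ne_zero i hqf).2
    have hx : blkV1 i.hN i.D f = β i.hN i.D i.hk (ιB (blkV1 i.hN i.D f)) := by rw [hι]
    have h := h342₀ J _ y' hs _ hΛ' f hx
    rw [hlen (w := chartY i f.src) hx] at h
    have hdist : (geo9K i).dist y y' ≤ (2 * (ℓ : ℝ) + 6) + (geo9K i).dist (ιB (blkV1 i.hN i.D f)) y' := by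
      rw [geo9K_dist_eq, geo9K_dist_eq, ← hbS₀, ← hx]
      have d1 : ((bondT i.D).dist (blkV1 i.hN i.D b) (β i.hN i.D i.hk y₂) : ℝ) ≤ (ℓ : ℝ) + 3 := dist_blkV1_beta_le_of_qwt_ne_zero i hqb
      have d2 : ((bondT i.D).dist (blkV1 i.hN i.D f) (β i.hN i.D i.hk y₂) : ℝ) ≤ (ℓ : ℝ) + 3 := dist_blkV1_beta_le_of_qwt_ne_zero i hqf
      rw [SimpleGraph.dist_comm (u := blkV1 i.hN i.D f)] at d2
      have t1 := dist_bondT_triangle i (blkV1 i.hN i.D b) (β i.hN i.D i.hk y₂) (blkV1 i.hN i.D f)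
      have t2 := dist_bondT_triangle i (blkV1 i.hN i.D b) (blkV1 i.hN i.D f) (β i.hN i.D i.hk y')
      change ((bondT i.D).dist (blkV1 i.hN i.D b) (β i.hN i.D i.hk y') : ℝ) ≤ _
      linarith
    have hexp : Real.exp (-(δ * (geo9K i).dist (ιB (blkV1 i.hN i.D f)) y')) ≤ Real.exp (δ * (2 * (ℓ : ℝ) + 6)) * E := by
      rw [hEdef, ← Real.exp_add]
      have := mul_le_mul_of_nonneg_left hdist hδ
      exact Real.exp_le_exp.2 (by linarith)
    have hAf : ‖A f‖ ≤ B₀ * (((ℓ : ℝ) + 1) ^ lvl i.hN i.D i.hk y₂ * |i.cf|⁻¹) ^ 2 * (Real.exp (δ * (2 * (ℓ : ℝ) + 6)) * E) * S := by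
      refine h.trans (mul_le_mul_of_nonneg_right ?_ hS0)
      exact mul_le_mul (mul_le_mul_of_nonneg_left (pow_le_pow_left₀ (by positivity)
        (mul_le_mul_of_nonneg_right (pow_le_pow_right₀ hL1 hlf) (by positivity)) 2) hB₀) hexp (Real.exp_pos _).le (by positivity)
    have hw := w_le_of_band i y₂
    have hw0 : 0 ≤ i.w y₂ := (i.hw y₂).le
    have hLc : (((ℓ + 1 : ℕ) : ℝ)) = (ℓ : ℝ) + 1 := by push_cast; ring
    rw [hLc] at hw
    have hpowj : (((ℓ : ℝ) + 1) ^ lvl i.hN i.D i.hk y₂) ^ (d + 1) ≤ (((ℓ : ℝ) + 1) ^ (lev + 1)) ^ (d + 1) :=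
      pow_le_pow_left₀ (by positivity) (pow_le_pow_right₀ hL1 hj₂) _
    calc i.w y₂ * ‖A f‖
        ≤ (b₁ * (((ℓ : ℝ) + 1) ^ lvl i.hN i.D i.hk y₂) ^ (d + 1) * (i.cf / ((ℓ : ℝ) + 1) ^ lvl i.hN i.D i.hk y₂) ^ 2)
            * (B₀ * (((ℓ : ℝ) + 1) ^ lvl i.hN i.D i.hk y₂ * |i.cf|⁻¹) ^ 2 * (Real.exp (δ * (2 * (ℓ : ℝ) + 6)) * E) * S) :=
          mul_le_mul hw hAf (norm_nonneg _) (by positivity)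
      _ = b₁ * B₀ * (((ℓ : ℝ) + 1) ^ lvl i.hN i.D i.hk y₂) ^ (d + 1) * Real.exp (δ * (2 * (ℓ : ℝ) + 6)) * E * S
            * ((i.cf / ((ℓ : ℝ) + 1) ^ lvl i.hN i.D i.hk y₂) ^ 2 * (((ℓ : ℝ) + 1) ^ lvl i.hN i.D i.hk y₂ * |i.cf|⁻¹) ^ 2) := by ring
      _ = b₁ * B₀ * (((ℓ : ℝ) + 1) ^ lvl i.hN i.D i.hk y₂) ^ (d + 1) * Real.exp (δ * (2 * (ℓ : ℝ) + 6)) * E * S := by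
          have hne : ((ℓ : ℝ) + 1) ^ lvl i.hN i.D i.hk y₂ ≠ 0 := pow_ne_zero _ hL0.ne'
          have e : (i.cf / ((ℓ : ℝ) + 1) ^ lvl i.hN i.D i.hk y₂) ^ 2 * (((ℓ : ℝ) + 1) ^ lvl i.hN i.D i.hk y₂ * |i.cf|⁻¹) ^ 2 = 1 := by
            rw [← mul_pow, div_mul_eq_mul_div, mul_div_assoc, mul_div_cancel_left₀ _ hne, mul_pow, inv_pow, sq_abs,
              mul_inv_cancel₀ (pow_ne_zero 2 i.hcf)]
          rw [e, mul_one]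
      _ ≤ P := by
          rw [hPdef]
          have : 0 ≤ b₁ * B₀ := by positivity
          have : 0 ≤ Real.exp (δ * (2 * (ℓ : ℝ) + 6)) * E * S := by positivity
          calc b₁ * B₀ * (((ℓ : ℝ) + 1) ^ lvl i.hN i.D i.hk y₂) ^ (d + 1) * Real.exp (δ * (2 * (ℓ : ℝ) + 6)) * E * S
              = b₁ * B₀ * (Real.exp (δ * (2 * (ℓ : ℝ) + 6)) * E * S) * (((ℓ : ℝ) + 1) ^ lvl i.hN i.D i.hk y₂) ^ (d + 1) := by ring
            _ ≤ b₁ * B₀ * (Real.exp (δ * (2 * (ℓ : ℝ) + 6)) * E * S) * (((ℓ : ℝ) + 1) ^ (lev + 1)) ^ (d + 1) :=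
                mul_le_mul_of_nonneg_left hpowj (by positivity)
            _ = _ := by ring
  -- (D) THE STAR CONSTANTS: every site E′₁-loc reads is within one lattice step of `S₀`, hence at level `≥ lev − 1`
  set wt : ℝ := ((((ℓ : ℝ) + 1) ^ lev)⁻¹) ^ 2 with hwtdef
  have hwt0 : 0 ≤ wt := by positivity
  have hstep : ∀ {w : SiteY i}, torusSupNorm (toKT i).NB (S₀.1 - w.1) ≤ 1 →
      ((((ℓ : ℝ) + 1) ^ levY i w)⁻¹) ^ 2 ≤ ((ℓ : ℝ) + 1) ^ 2 * wt := fun {w} hw =>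
    inv_pow_sq_le_of_le_succ hL1 (lev_le_succ_of_touch' i hw)
  -- δ_P at the plaquettes `p_{μλ}(S₀ − e_μ)`
  have hP' : ∀ (μ lam : Fin (d + 1)) (Y : 𝔸),
      ‖R (plaqU (shiftY i) (UboxY i U) μ lam ((shiftY i μ).symm (chartY i b.src))) Y - Y‖ ≤ δP * ((ℓ : ℝ) + 1) ^ 2 * wt * ‖Y‖ := by
    intro μ lam Y
    refine (hP μ lam _ Y).trans ?_
    have hw := hstep (torusSupNorm_sub_shiftY_le_one i μ S₀).2
    have := mul_le_mul_of_nonneg_left hw hδP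
    calc δP * ((((ℓ : ℝ) + 1) ^ levY i ((shiftY i μ).symm S₀))⁻¹) ^ 2 * ‖Y‖ ≤ δP * (((ℓ : ℝ) + 1) ^ 2 * wt) * ‖Y‖ :=
          mul_le_mul_of_nonneg_right this (norm_nonneg _)
      _ = _ := by ring
  -- δ_K at `S₀`
  have hKc' : ∀ a e (μ : Fin (d + 1)) (Z : 𝔸),
      ‖R (UboxY i U μ ((shiftY i μ).symm (chartY i b.src)))⁻¹ (jIns i U a e ((shiftY i μ).symm (chartY i b.src))
          (R (UboxY i U μ ((shiftY i μ).symm (chartY i b.src))) Z)) - jIns i U a e (chartY i b.src) Z‖ ≤ δK * |i.cf| * wt * ‖Z‖ :=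
    fun a e μ Z => hKc a e μ S₀ Z
  -- δ_I at the plaquettes through `b`
  have hI' : ∀ (p : PlaqY i) (m : Fin 4), edgeY i p m = b → ‖((i.cf ^ 2 : ℝ) : ℂ) • imHolY i U p‖ ≤ δI * i.cf ^ 2 * ((ℓ : ℝ) + 1) ^ 2 * wt := by
    intro p m hm
    refine (hI p).trans ?_
    have t₁ : torusSupNorm (toKT i).NB (S₀.1 - (chartY i p.src).1) ≤ 1 := by
      rw [hS₀def, ← hm]; exact touch_symm i (touch_src_edgeY i p m)
    have hw := hstep t₁
    have := mul_le_mul_of_nonneg_left hw (by positivity : 0 ≤ δI * i.cf ^ 2)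
    calc δI * i.cf ^ 2 * ((((ℓ : ℝ) + 1) ^ levY i (chartY i p.src))⁻¹) ^ 2 ≤ δI * i.cf ^ 2 * (((ℓ : ℝ) + 1) ^ 2 * wt) := this
      _ = _ := by ring
  -- (E) E′₁-loc at these data, the column sum, and the bookkeeping
  have hmain := norm_KhBY_hTY_apply_le_loc i c parB U hU hT (δP := δP * ((ℓ : ℝ) + 1) ^ 2 * wt) (ρ := ρ) (δK := δK * |i.cf| * wt)
    (δI := δI * i.cf ^ 2 * ((ℓ : ℝ) + 1) ^ 2 * wt) (by positivity) hρ (by positivity) (by positivity) hRe A b hP' hKc' hI'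
    (G₀ := G₀) (G₁ := G₁) (P := P) hG₀0 hA₀ hA₀' hA₁ hAP
  have hθQ : 0 ≤ 2 * (sLipT d ℓ / (((ℓ : ℝ) + 1) * i.Mh) * (((ℓ : ℝ) + 1) + 3)) * P := by
    have := sLipT_nonneg d ℓ; positivity
  have hcol := sum_abs_qsK_le i b
  have hLc : (((ℓ + 1 : ℕ) : ℝ)) = (ℓ : ℝ) + 1 := by push_cast; ring
  rw [hLc] at hcol
  have hQ : 2 * (sLipT d ℓ / (((ℓ : ℝ) + 1) * i.Mh) * (((ℓ : ℝ) + 1) + 3)) * P * ∑ y₂, |qsK i b y₂|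
      ≤ 4 * (sLipT d ℓ / (((ℓ : ℝ) + 1) * i.Mh) * (((ℓ : ℝ) + 1) + 3))
          * (b₁ * B₀ * ((ℓ : ℝ) + 1) ^ (d + 1) * Real.exp (δ * (2 * (ℓ : ℝ) + 6)) * E * S) := by
    refine (mul_le_mul_of_nonneg_left hcol hθQ).trans (le_of_eq ?_)
    rw [hPdef]
    have hne : (((ℓ : ℝ) + 1) ^ (d + 1)) ^ lev ≠ 0 := by positivity
    have e : (((ℓ : ℝ) + 1) ^ (lev + 1)) ^ (d + 1) * ((((ℓ : ℝ) + 1) ^ (d + 1)) ^ lev)⁻¹ = ((ℓ : ℝ) + 1) ^ (d + 1) := by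
      rw [← pow_mul, ← pow_mul, show (lev + 1) * (d + 1) = (d + 1) * lev + (d + 1) by ring, pow_add, mul_comm (((ℓ : ℝ) + 1) ^ ((d + 1) * lev)),
        mul_assoc, mul_inv_cancel₀ (by rw [pow_mul]; exact hne), mul_one]
    calc 2 * (sLipT d ℓ / (((ℓ : ℝ) + 1) * i.Mh) * (((ℓ : ℝ) + 1) + 3))
          * (b₁ * B₀ * (((ℓ : ℝ) + 1) ^ (lev + 1)) ^ (d + 1) * Real.exp (δ * (2 * (ℓ : ℝ) + 6)) * E * S)
          * (2 * ((((ℓ : ℝ) + 1) ^ (d + 1)) ^ lev)⁻¹)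
        = 4 * (sLipT d ℓ / (((ℓ : ℝ) + 1) * i.Mh) * (((ℓ : ℝ) + 1) + 3))
          * (b₁ * B₀ * ((((ℓ : ℝ) + 1) ^ (lev + 1)) ^ (d + 1) * ((((ℓ : ℝ) + 1) ^ (d + 1)) ^ lev)⁻¹) * Real.exp (δ * (2 * (ℓ : ℝ) + 6)) * E * S) := by
          ring
      _ = _ := by rw [e]
  rw [C1F_div_bigSide_eq i c.1.1, C2X_div_bigSide_sq_eq i c] at hmain
  have hX := hmain.trans (add_le_add le_rfl hQ)
  rw [hG₀def, hG₁def, hwtdef, show i.cf ^ 2 = |i.cf| ^ 2 from (sq_abs i.cf).symm] at hX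
  have hfin := arith389BLoc (X := ‖KhBY i (hTY i c) parB U A b‖) (dd := d + 1) (Nat.cast_nonneg d) hL1 hMh1 (C1F_nonneg d ℓ) (C2X_bounds d ℓ).2.2
    hB₀ hcf1 (Real.exp_pos (2 * δ)).le hE0 hS0 hρ hδP hδK hδI hlev hX
  unfold theta389B
  exact hfin

end Literature.MathematicalPhysics.QuantumFieldTheory.Balaban1983to89.B9Thm310CommutatorBound389BLoc

end
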